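import Mathlib
import Literature.Computability.AlgebraicComplexity.NewtonPolygonTauProductBounds
import Summits.ValiantsHypothesis.ValiantsHypothesis.Theorems.NewtonUnitEquationsDissociatedUniformTotalsLawChartTops
import HarnessLib

/-!
# Crux `NewtonUnitEquations.DissociatedUniform` (stmt-ValiantsHypothesis-5905): totals law, the binary row — chart tops of the parity classes

Second tool file for the `q = 2` row of the typed general totals law `TotalsLawN.TotalsLawGeneral` (memo
`Cruxes/DissociatedUniform/NOTES-t1.md` §5(iv); crit-3 S2).  For `G = ℤ/2` an `n`-coordinate (Q**) design is, up to translation,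
the family of SUBSET SUMS `P_K = ∑_{j ∈ K} v_j` of `n` planar vectors, split into the two PARITY CLASSES `|K|` even / odd.  Along an
affine chart of weights `w_t = (σ, t)` (KPTT `IsStrictTop` calculus) write `ℓ_i(t) = ⟨w_t, v_i⟩ = σ v_{i,0} + t v_{i,1}`,
`J(t) = {i : ℓ_i(t) > 0}` (the sign pattern: `P_{J(t)}` is the top subset sum) and `i₀(t)` = the least index minimising `|ℓ_i(t)|`.

STATIC TOP-TWO LEMMA (`top_mem_pairAt`, no general-position hypothesis): a strict top of the parity class `e` at weight `w_t` is
`P_{J(t)}` if `|J(t)| ≡ e`, and `P_{J(t) △ {i₀(t)}}` otherwise — the score of `P_K` is `score(J) - ∑_{K △ J} |ℓ_i|`.  So both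
class tops at time `t` lie in the tagged pair `pairAt t = {(P_J, |J|), (P_{J △ i₀}, |J| + 1)}`.

Also here, for the kinetic count of the companion file `…TotalsLawBinaryWalk`: the finite EVENT set `events` (roots of the `ℓ_i`
and pairwise crossing times of the `|ℓ_i|`, with harmless junk values), and what holds OFF it (`GENERIC` times): a vanishing `ℓ_i`
is chart-null, and `|ℓ_i| = |ℓ_k|` forces identical functions (`SameV`); the argmin set at a generic time is a full `SameV`-class;
sign flips between generic times locate a root strictly between.
[folklore: extreme points of the hull of a finite set lie in the set]
-/

set_option linter.dupNamespace false -- `ValiantsHypothesis.ValiantsHypothesis` (summit = problem) in every name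

open scoped Classical BigOperators
open Finset Matrix
open Literature.Computability.AlgebraicComplexity.KPTT.PlanarMinkowski (IsStrictTop)

namespace Summit.ValiantsHypothesis.ValiantsHypothesis.Theorems.NewtonUnitEquationsDissociatedUniform

namespace TotalsLawN

namespace Binary

variable {m : ℕ}

/-! ### Subset sums and parity classes -/

/-- The subset sum `P_K = ∑_{j ∈ K} v_j`. -/
noncomputable def P (v : Fin (m + 1) → (Fin 2 → ℝ)) (K : Finset (Fin (m + 1))) : Fin 2 → ℝ :=
  ∑ j ∈ K, v j

/-- The parity class `e`: all subset sums `P_K` with `|K| ≡ e (mod 2)`. -/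
noncomputable def cls (v : Fin (m + 1) → (Fin 2 → ℝ)) (e : ZMod 2) : Finset (Fin 2 → ℝ) :=
  (univ.filter fun K : Finset (Fin (m + 1)) => (K.card : ZMod 2) = e).image (P v)

/-- Toggle the membership of `i` in `K` (`K △ {i}`). -/
def tog (K : Finset (Fin (m + 1))) (i : Fin (m + 1)) : Finset (Fin (m + 1)) :=
  if i ∈ K then K.erase i else insert i K

/-- Membership in a parity class. [folklore] -/
theorem mem_cls {v : Fin (m + 1) → (Fin 2 → ℝ)} {e : ZMod 2} {x : Fin 2 → ℝ} :
    x ∈ cls v e ↔ ∃ K : Finset (Fin (m + 1)), (K.card : ZMod 2) = e ∧ P v K = x := by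
  simp [cls]

/-- `P_K ∈ cls (|K| mod 2)`. [folklore] -/
theorem P_mem_cls (v : Fin (m + 1) → (Fin 2 → ℝ)) (K : Finset (Fin (m + 1))) :
    P v K ∈ cls v (K.card : ZMod 2) :=
  mem_cls.2 ⟨K, rfl, rfl⟩

/-- Toggling flips the parity of the cardinality. [folklore] -/
theorem card_tog (K : Finset (Fin (m + 1))) (i : Fin (m + 1)) :
    ((tog K i).card : ZMod 2) = (K.card : ZMod 2) + 1 := by
  unfold tog
  split_ifs with h
  · rw [Finset.card_erase_of_mem h]
    have : ((K.card - 1 : ℕ) : ZMod 2) + 1 = (K.card : ZMod 2) := by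
      rw [Nat.cast_sub (Finset.card_pos.2 ⟨i, h⟩), Nat.cast_one]; ring
    rw [← this, add_assoc, show (1 : ZMod 2) + 1 = 0 by decide, add_zero]
  · rw [Finset.card_insert_of_notMem h, Nat.cast_add, Nat.cast_one]

/-- Toggling twice restores the set. [folklore] -/
theorem tog_tog (K : Finset (Fin (m + 1))) (i : Fin (m + 1)) : tog (tog K i) i = K := by
  unfold tog
  split_ifs with h h' h'
  · exact absurd h' (Finset.notMem_erase i K)
  · exact Finset.insert_erase h
  · exact Finset.erase_insert h
  · exact absurd (Finset.mem_insert_self i K) h'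

/-- The subset sum after toggling. [folklore] -/
theorem P_tog (v : Fin (m + 1) → (Fin 2 → ℝ)) (K : Finset (Fin (m + 1))) (i : Fin (m + 1)) :
    P v (tog K i) = if i ∈ K then P v K - v i else P v K + v i := by
  unfold tog P
  split_ifs with h
  · rw [Finset.sum_erase_eq_sub h]
  · rw [Finset.sum_insert h, add_comm]

/-! ### The chart pairing -/

/-- `ℓ_i(t) = ⟨(σ, t), v_i⟩ = σ v_{i,0} + t v_{i,1}`. -/
def ell (v : Fin (m + 1) → (Fin 2 → ℝ)) (σ : ℝ) (i : Fin (m + 1)) (t : ℝ) : ℝ :=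
  σ * v i 0 + t * v i 1

/-- The score of a subset sum: `⟨w_t, P_K⟩ = ∑_{j ∈ K} ℓ_j(t)`. [folklore] -/
theorem chart_dot_P (v : Fin (m + 1) → (Fin 2 → ℝ)) (σ t : ℝ) (K : Finset (Fin (m + 1))) :
    ![σ, t] ⬝ᵥ P v K = ∑ j ∈ K, ell v σ j t := by
  rw [TotalsLaw.chart_dotProduct, P, Finset.sum_apply, Finset.sum_apply, Finset.mul_sum, Finset.mul_sum, ← Finset.sum_add_distrib]
  rfl

/-- The sign pattern `J(t) = {i : ℓ_i(t) > 0}`: `P_{J(t)}` is the top subset sum at weight `(σ, t)`. -/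
noncomputable def J (v : Fin (m + 1) → (Fin 2 → ℝ)) (σ t : ℝ) : Finset (Fin (m + 1)) :=
  univ.filter fun i => 0 < ell v σ i t

/-- The argmin set of `|ℓ_i(t)|`. -/
noncomputable def Amin (v : Fin (m + 1) → (Fin 2 → ℝ)) (σ t : ℝ) : Finset (Fin (m + 1)) :=
  univ.filter fun i => ∀ k, |ell v σ i t| ≤ |ell v σ k t|

/-- The argmin set is nonempty. [folklore] -/
theorem Amin_nonempty (v : Fin (m + 1) → (Fin 2 → ℝ)) (σ t : ℝ) : (Amin v σ t).Nonempty := by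
  obtain ⟨i, -, hi⟩ := Finset.exists_min_image univ (fun i => |ell v σ i t|) univ_nonempty
  exact ⟨i, Finset.mem_filter.2 ⟨mem_univ _, fun k => hi k (mem_univ _)⟩⟩

/-- `i₀(t)`: the least index minimising `|ℓ_i(t)|`. -/
noncomputable def i0 (v : Fin (m + 1) → (Fin 2 → ℝ)) (σ t : ℝ) : Fin (m + 1) :=
  (Amin v σ t).min' (Amin_nonempty v σ t)

/-- `i₀(t)` is a minimiser. [folklore] -/
theorem i0_mem (v : Fin (m + 1) → (Fin 2 → ℝ)) (σ t : ℝ) : i0 v σ t ∈ Amin v σ t :=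
  Finset.min'_mem _ _

/-- Membership in the argmin set. [folklore] -/
theorem mem_Amin {v : Fin (m + 1) → (Fin 2 → ℝ)} {σ t : ℝ} {i : Fin (m + 1)} :
    i ∈ Amin v σ t ↔ ∀ k, |ell v σ i t| ≤ |ell v σ k t| := by
  simp [Amin]

/-- Membership in the sign pattern. [folklore] -/
theorem mem_J {v : Fin (m + 1) → (Fin 2 → ℝ)} {σ t : ℝ} {i : Fin (m + 1)} :
    i ∈ J v σ t ↔ 0 < ell v σ i t := by
  simp [J]

/-- The tagged pair of candidate tops at time `t`: `(P_J, |J|)` and `(P_{J △ i₀}, |J| + 1)`. -/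
noncomputable def pairAt (v : Fin (m + 1) → (Fin 2 → ℝ)) (σ t : ℝ) : Finset ((Fin 2 → ℝ) × ZMod 2) :=
  {(P v (J v σ t), ((J v σ t).card : ZMod 2)),
    (P v (tog (J v σ t) (i0 v σ t)), ((J v σ t).card : ZMod 2) + 1)}

/-- The tagged pair has at most two elements. [folklore] -/
theorem card_pairAt_le (v : Fin (m + 1) → (Fin 2 → ℝ)) (σ t : ℝ) : (pairAt v σ t).card ≤ 2 :=
  (Finset.card_insert_le _ _).trans (by rw [Finset.card_singleton])

/-! ### The score identity and the static top-two lemma -/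

/-- **Score identity.** `∑_{j ∈ K} ℓ_j = ∑_{j ∈ J} ℓ_j - ∑_{j ∈ K \ J} |ℓ_j| - ∑_{j ∈ J \ K} |ℓ_j|` for the sign pattern `J`.
[folklore] -/
theorem score_eq (v : Fin (m + 1) → (Fin 2 → ℝ)) (σ t : ℝ) (K : Finset (Fin (m + 1))) :
    ∑ j ∈ K, ell v σ j t = ∑ j ∈ J v σ t, ell v σ j t
      - ∑ j ∈ K \ J v σ t, |ell v σ j t| - ∑ j ∈ J v σ t \ K, |ell v σ j t| := by
  have hK := Finset.sum_inter_add_sum_sdiff K (J v σ t) (fun j => ell v σ j t)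
  have hJ := Finset.sum_inter_add_sum_sdiff (J v σ t) K (fun j => ell v σ j t)
  have h1 : ∑ j ∈ K \ J v σ t, |ell v σ j t| = - ∑ j ∈ K \ J v σ t, ell v σ j t := by
    rw [← Finset.sum_neg_distrib]
    refine Finset.sum_congr rfl fun j hj => ?_
    have : ¬ 0 < ell v σ j t := fun h => (Finset.mem_sdiff.1 hj).2 (mem_J.2 h)
    exact abs_of_nonpos (not_lt.1 this)
  have h2 : ∑ j ∈ J v σ t \ K, |ell v σ j t| = ∑ j ∈ J v σ t \ K, ell v σ j t :=
    Finset.sum_congr rfl fun j hj => abs_of_pos (mem_J.1 (Finset.mem_sdiff.1 hj).1)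
  rw [h1, h2, Finset.inter_comm] at *
  rw [Finset.inter_comm] at hJ
  linarith

/-- Every subset sum scores at most the top pattern: `∑_K ℓ ≤ ∑_J ℓ`. [folklore] -/
theorem score_le (v : Fin (m + 1) → (Fin 2 → ℝ)) (σ t : ℝ) (K : Finset (Fin (m + 1))) :
    ∑ j ∈ K, ell v σ j t ≤ ∑ j ∈ J v σ t, ell v σ j t := by
  rw [score_eq v σ t K]
  have h1 : 0 ≤ ∑ j ∈ K \ J v σ t, |ell v σ j t| := Finset.sum_nonneg fun j _ => abs_nonneg _
  have h2 : 0 ≤ ∑ j ∈ J v σ t \ K, |ell v σ j t| := Finset.sum_nonneg fun j _ => abs_nonneg _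
  linarith

/-- A subset sum other than the top pattern loses at least the least `|ℓ_i|`. [folklore] -/
theorem score_le_sub (v : Fin (m + 1) → (Fin 2 → ℝ)) (σ t : ℝ) {K : Finset (Fin (m + 1))} (hK : K ≠ J v σ t) :
    ∑ j ∈ K, ell v σ j t ≤ ∑ j ∈ J v σ t, ell v σ j t - |ell v σ (i0 v σ t) t| := by
  rw [score_eq v σ t K]
  have h1 : 0 ≤ ∑ j ∈ K \ J v σ t, |ell v σ j t| := Finset.sum_nonneg fun j _ => abs_nonneg _
  have h2 : 0 ≤ ∑ j ∈ J v σ t \ K, |ell v σ j t| := Finset.sum_nonneg fun j _ => abs_nonneg _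
  have hmin := mem_Amin.1 (i0_mem v σ t)
  -- some index lies in the symmetric difference
  by_cases h : (K \ J v σ t).Nonempty
  · obtain ⟨j, hj⟩ := h
    have h3 : |ell v σ j t| ≤ ∑ j ∈ K \ J v σ t, |ell v σ j t| :=
      Finset.single_le_sum (f := fun j => |ell v σ j t|) (fun j _ => abs_nonneg _) hj
    linarith [hmin j]
  · have h' : (J v σ t \ K).Nonempty := by
      by_contra h'
      apply hK
      have e1 : K \ J v σ t = ∅ := Finset.not_nonempty_iff_eq_empty.1 h
      have e2 : J v σ t \ K = ∅ := Finset.not_nonempty_iff_eq_empty.1 h'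
      exact Finset.Subset.antisymm (Finset.sdiff_eq_empty_iff_subset.1 e1) (Finset.sdiff_eq_empty_iff_subset.1 e2)
    obtain ⟨j, hj⟩ := h'
    have h3 : |ell v σ j t| ≤ ∑ j ∈ J v σ t \ K, |ell v σ j t| :=
      Finset.single_le_sum (f := fun j => |ell v σ j t|) (fun j _ => abs_nonneg _) hj
    linarith [hmin j]

/-- The runner-up across parity scores exactly `score(J) - |ℓ_{i₀}|`. [folklore] -/
theorem score_tog_i0 (v : Fin (m + 1) → (Fin 2 → ℝ)) (σ t : ℝ) :
    ∑ j ∈ tog (J v σ t) (i0 v σ t), ell v σ j t = ∑ j ∈ J v σ t, ell v σ j t - |ell v σ (i0 v σ t) t| := by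
  unfold tog
  split_ifs with h
  · rw [Finset.sum_erase_eq_sub h, abs_of_pos (mem_J.1 h)]
  · rw [Finset.sum_insert h, abs_of_nonpos (not_lt.1 fun h' => h (mem_J.2 h'))]
    ring

/-- In `ℤ/2`, two distinct residues differ by `1`. [folklore] -/
theorem zmod_two_eq_add_one_of_ne {a b : ZMod 2} (h : a ≠ b) : b = a + 1 := by
  revert a b; decide

/-- **Static top-two lemma.**  A strict top of the parity class `e` at weight `(σ, t)` is the top pattern `P_{J(t)}` (tag `|J|`)
or the runner-up `P_{J(t) △ {i₀(t)}}` (tag `|J| + 1`), according to the parity of `|J(t)|`: `(x, e) ∈ pairAt t`.  No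
general-position hypothesis. [folklore] -/
theorem top_mem_pairAt {v : Fin (m + 1) → (Fin 2 → ℝ)} {σ t : ℝ} {e : ZMod 2} {x : Fin 2 → ℝ}
    (hx : IsStrictTop ![σ, t] (cls v e) x) : (x, e) ∈ pairAt v σ t := by
  obtain ⟨K, hKe, hKx⟩ := mem_cls.1 hx.1
  rw [pairAt, Finset.mem_insert, Finset.mem_singleton]
  by_cases hpar : ((J v σ t).card : ZMod 2) = e
  · left
    by_contra hne
    have hne' : P v (J v σ t) ≠ x := fun h => hne (by rw [h, hpar])
    have hlt := hx.2 _ (hpar ▸ P_mem_cls v (J v σ t)) hne'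
    rw [← hKx, chart_dot_P, chart_dot_P] at hlt
    exact absurd (score_le v σ t K) (not_le.2 hlt)
  · right
    have he : e = ((J v σ t).card : ZMod 2) + 1 := zmod_two_eq_add_one_of_ne hpar
    by_contra hne
    have hne' : P v (tog (J v σ t) (i0 v σ t)) ≠ x := fun h => hne (by rw [h, he])
    have hmem : P v (tog (J v σ t) (i0 v σ t)) ∈ cls v e := by
      rw [he, ← card_tog]; exact P_mem_cls v _
    have hlt := hx.2 _ hmem hne'
    rw [← hKx, chart_dot_P, chart_dot_P, score_tog_i0] at hlt
    have hKJ : K ≠ J v σ t := fun h => hpar (by rw [← h, hKe])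
    exact absurd (score_le_sub v σ t hKJ) (not_le.2 hlt)

/-! ### Events and generic times -/

/-- The chart coefficients `α_i = σ v_{i,0}`, `β_i = v_{i,1}` of `ℓ_i(t) = α_i + t β_i`. -/
def alpha (v : Fin (m + 1) → (Fin 2 → ℝ)) (σ : ℝ) (i : Fin (m + 1)) : ℝ := σ * v i 0

/-- The slope `β_i = v_{i,1}` of `ℓ_i`. -/
def beta (v : Fin (m + 1) → (Fin 2 → ℝ)) (i : Fin (m + 1)) : ℝ := v i 1

/-- `ℓ_i(t) = α_i + t β_i`. [folklore] -/
theorem ell_eq (v : Fin (m + 1) → (Fin 2 → ℝ)) (σ : ℝ) (i : Fin (m + 1)) (t : ℝ) :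
    ell v σ i t = alpha v σ i + t * beta v i := rfl

/-- `i` and `k` have IDENTICAL functions `|ℓ_i| = |ℓ_k|`: `(α_i, β_i) = ±(α_k, β_k)`. -/
def SameV (v : Fin (m + 1) → (Fin 2 → ℝ)) (σ : ℝ) (i k : Fin (m + 1)) : Prop :=
  (alpha v σ i = alpha v σ k ∧ beta v i = beta v k) ∨ (alpha v σ i = -alpha v σ k ∧ beta v i = -beta v k)

/-- Identical functions take equal absolute values everywhere. [folklore] -/
theorem SameV.abs_eq {v : Fin (m + 1) → (Fin 2 → ℝ)} {σ : ℝ} {i k : Fin (m + 1)} (h : SameV v σ i k) (t : ℝ) :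
    |ell v σ i t| = |ell v σ k t| := by
  rw [ell_eq, ell_eq]
  rcases h with ⟨h1, h2⟩ | ⟨h1, h2⟩
  · rw [h1, h2]
  · rw [h1, h2, show -alpha v σ k + t * -beta v k = -(alpha v σ k + t * beta v k) by ring, abs_neg]

/-- `SameV` is symmetric. [folklore] -/
theorem SameV.symm {v : Fin (m + 1) → (Fin 2 → ℝ)} {σ : ℝ} {i k : Fin (m + 1)} (h : SameV v σ i k) :
    SameV v σ k i := by
  rcases h with ⟨h1, h2⟩ | ⟨h1, h2⟩
  · exact Or.inl ⟨h1.symm, h2.symm⟩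
  · exact Or.inr ⟨by rw [h1, neg_neg], by rw [h2, neg_neg]⟩

/-- `SameV` is transitive. [folklore] -/
theorem SameV.trans {v : Fin (m + 1) → (Fin 2 → ℝ)} {σ : ℝ} {i j k : Fin (m + 1)} (h : SameV v σ i j)
    (h' : SameV v σ j k) : SameV v σ i k := by
  rcases h with ⟨h1, h2⟩ | ⟨h1, h2⟩ <;> rcases h' with ⟨h3, h4⟩ | ⟨h3, h4⟩
  · exact Or.inl ⟨h1.trans h3, h2.trans h4⟩
  · exact Or.inr ⟨h1.trans h3, h2.trans h4⟩
  · exact Or.inr ⟨by rw [h1, h3], by rw [h2, h4]⟩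
  · exact Or.inl ⟨by rw [h1, h3, neg_neg], by rw [h2, h4, neg_neg]⟩

/-- The EVENT times of the chart: the roots `-α_i/β_i` and the pairwise crossing times of the `|ℓ_i|` (junk values for
vanishing denominators are included and harmless). -/
noncomputable def events (v : Fin (m + 1) → (Fin 2 → ℝ)) (σ : ℝ) : Finset ℝ :=
  univ.image (fun i => -alpha v σ i / beta v i) ∪
    ((univ ×ˢ univ).image fun p : Fin (m + 1) × Fin (m + 1) =>
      -(alpha v σ p.1 - alpha v σ p.2) / (beta v p.1 - beta v p.2)) ∪
    ((univ ×ˢ univ).image fun p : Fin (m + 1) × Fin (m + 1) =>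
      -(alpha v σ p.1 + alpha v σ p.2) / (beta v p.1 + beta v p.2))

/-- The root of a non-null `ℓ_i` is an event. [folklore] -/
theorem root_mem_events {v : Fin (m + 1) → (Fin 2 → ℝ)} {σ t : ℝ} {i : Fin (m + 1)} (h0 : ell v σ i t = 0)
    (hi : ¬ (alpha v σ i = 0 ∧ beta v i = 0)) : t ∈ events v σ := by
  rw [ell_eq] at h0
  have hb : beta v i ≠ 0 := by
    intro hb; rw [hb, mul_zero, add_zero] at h0; exact hi ⟨h0, hb⟩
  have ht : t = -alpha v σ i / beta v i := by field_simp; linarith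
  rw [events, Finset.mem_union, Finset.mem_union]
  exact Or.inl (Or.inl (Finset.mem_image.2 ⟨i, mem_univ _, ht.symm⟩))

/-- A crossing time of two NON-identical functions `|ℓ_i|`, `|ℓ_k|` is an event. [folklore] -/
theorem cross_mem_events {v : Fin (m + 1) → (Fin 2 → ℝ)} {σ t : ℝ} {i k : Fin (m + 1)}
    (h : |ell v σ i t| = |ell v σ k t|) (hne : ¬ SameV v σ i k) : t ∈ events v σ := by
  rw [ell_eq, ell_eq] at h
  rw [events, Finset.mem_union, Finset.mem_union]
  rcases abs_eq_abs.1 h with h1 | h1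
  · -- `ℓ_i = ℓ_k`
    by_cases hb : beta v i - beta v k = 0
    · have ha : alpha v σ i = alpha v σ k := by
        have : t * (beta v i - beta v k) = 0 := by rw [hb, mul_zero]
        linarith
      exact absurd (Or.inl ⟨ha, sub_eq_zero.1 hb⟩) hne
    · have ht : t = -(alpha v σ i - alpha v σ k) / (beta v i - beta v k) := by field_simp; linarith
      exact Or.inl (Or.inr (Finset.mem_image.2 ⟨(i, k), Finset.mem_product.2 ⟨mem_univ _, mem_univ _⟩, ht.symm⟩))
  · -- `ℓ_i = -ℓ_k`
    by_cases hb : beta v i + beta v k = 0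
    · have ha : alpha v σ i = -alpha v σ k := by
        have : t * (beta v i + beta v k) = 0 := by rw [hb, mul_zero]
        linarith
      exact absurd (Or.inr ⟨ha, eq_neg_of_add_eq_zero_left hb⟩) hne
    · have ht : t = -(alpha v σ i + alpha v σ k) / (beta v i + beta v k) := by field_simp; linarith
      exact Or.inr (Finset.mem_image.2 ⟨(i, k), Finset.mem_product.2 ⟨mem_univ _, mem_univ _⟩, ht.symm⟩)

/-- Off the events a vanishing `ℓ_i` is chart-null (`α_i = β_i = 0`). [folklore] -/
theorem null_of_ell_eq_zero {v : Fin (m + 1) → (Fin 2 → ℝ)} {σ t : ℝ} (ht : t ∉ events v σ) {i : Fin (m + 1)}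
    (h0 : ell v σ i t = 0) : alpha v σ i = 0 ∧ beta v i = 0 := by
  by_contra h
  exact ht (root_mem_events h0 h)

/-- Off the events, equal absolute values force identical functions. [folklore] -/
theorem sameV_of_abs_eq {v : Fin (m + 1) → (Fin 2 → ℝ)} {σ t : ℝ} (ht : t ∉ events v σ) {i k : Fin (m + 1)}
    (h : |ell v σ i t| = |ell v σ k t|) : SameV v σ i k := by
  by_contra hne
  exact ht (cross_mem_events h hne)

/-- **The argmin set at a generic time is a full class of identical functions.** [folklore] -/
theorem mem_Amin_iff_sameV {v : Fin (m + 1) → (Fin 2 → ℝ)} {σ t : ℝ} (ht : t ∉ events v σ) {j k : Fin (m + 1)}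
    (hj : j ∈ Amin v σ t) : k ∈ Amin v σ t ↔ SameV v σ j k := by
  constructor
  · intro hk
    exact sameV_of_abs_eq ht (le_antisymm (mem_Amin.1 hj k) (mem_Amin.1 hk j))
  · intro h
    exact mem_Amin.2 fun l => by rw [← h.abs_eq t]; exact mem_Amin.1 hj l

/-- At generic times the least minimiser determines the argmin set. [folklore] -/
theorem Amin_eq_of_i0_mem {v : Fin (m + 1) → (Fin 2 → ℝ)} {σ s s' : ℝ} (hs : s ∉ events v σ) (hs' : s' ∉ events v σ)
    (h : i0 v σ s' ∈ Amin v σ s) : Amin v σ s = Amin v σ s' := by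
  ext k
  rw [mem_Amin_iff_sameV hs h, mem_Amin_iff_sameV hs' (i0_mem v σ s')]

/-- At generic times the least minimisers agree as soon as one of them minimises at the other time. [folklore] -/
theorem i0_eq_of_i0_mem {v : Fin (m + 1) → (Fin 2 → ℝ)} {σ s s' : ℝ} (hs : s ∉ events v σ) (hs' : s' ∉ events v σ)
    (h : i0 v σ s' ∈ Amin v σ s) : i0 v σ s = i0 v σ s' := by
  unfold i0
  congr 1
  exact Amin_eq_of_i0_mem hs hs' h

/-- **Sign flips locate a root.**  If the sign of `ℓ_i` differs at two generic times `p < s`, then `β_i ≠ 0` and the root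
`-α_i/β_i` of `ℓ_i` lies strictly between (and is an event). [folklore] -/
theorem root_between_of_flip {v : Fin (m + 1) → (Fin 2 → ℝ)} {σ p s : ℝ} (hp : p ∉ events v σ) (hs : s ∉ events v σ)
    (hps : p < s) {i : Fin (m + 1)} (hflip : ¬ (i ∈ J v σ p ↔ i ∈ J v σ s)) :
    beta v i ≠ 0 ∧ p < -alpha v σ i / beta v i ∧ -alpha v σ i / beta v i < s ∧
      ell v σ i (-alpha v σ i / beta v i) = 0 := by
  rw [mem_J, mem_J, ell_eq, ell_eq] at hflip
  -- `ℓ_i` does not vanish at the generic times unless null, and a null index never flips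
  have hnn : ¬ (alpha v σ i = 0 ∧ beta v i = 0) := by
    rintro ⟨ha, hb⟩
    apply hflip
    rw [ha, hb]; simp
  have hp0 : alpha v σ i + p * beta v i ≠ 0 := fun h => hnn (null_of_ell_eq_zero hp h)
  have hs0 : alpha v σ i + s * beta v i ≠ 0 := fun h => hnn (null_of_ell_eq_zero hs h)
  have hb : beta v i ≠ 0 := by
    intro hb
    apply hflip
    rw [hb, mul_zero, mul_zero]
  -- opposite strict signs
  have hprod : (alpha v σ i + p * beta v i) * (alpha v σ i + s * beta v i) < 0 := by
    rcases lt_or_gt_of_ne hp0 with h1 | h1 <;> rcases lt_or_gt_of_ne hs0 with h2 | h2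
    · exact absurd (iff_of_false (not_lt.2 h1.le) (not_lt.2 h2.le)) hflip
    · exact mul_neg_of_neg_of_pos h1 h2
    · exact mul_neg_of_pos_of_neg h1 h2
    · exact absurd (iff_of_true h1 h2) hflip
  set r := -alpha v σ i / beta v i with hr
  have hfac : ∀ t, alpha v σ i + t * beta v i = beta v i * (t - r) := by
    intro t; rw [hr]; field_simp; ring
  rw [hfac, hfac] at hprod
  have hb2 : 0 < beta v i ^ 2 := by positivity
  have hprod' : (p - r) * (s - r) < 0 := by nlinarith
  have hpr : p - r < 0 := by
    by_contra h
    have : 0 ≤ (p - r) * (s - r) := mul_nonneg (not_lt.1 h) (by linarith)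
    linarith
  have hsr : 0 < s - r := by
    by_contra h
    have : 0 ≤ (p - r) * (s - r) := by nlinarith [not_lt.1 h]
    linarith
  refine ⟨hb, by linarith, by linarith, ?_⟩
  rw [ell_eq, hfac, sub_self, mul_zero]

end Binary

end TotalsLawN

end Summit.ValiantsHypothesis.ValiantsHypothesis.Theorems.NewtonUnitEquationsDissociatedUniform
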